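import Summits.CriticalPhenomena.SAWScalingLimit.Theses.SAWLoopFugacityFlow
import Summits.CriticalPhenomena.SAWScalingLimit.Theorems.AvoidanceLimit.Negative.AvoidanceLimitExponentRigidity
import Summits.CriticalPhenomena.SAWScalingLimit.Theorems.SAWLoopFugacityFlowAvoidanceLimitAnchorDefs
import Summits.CriticalPhenomena.SAWScalingLimit.Theorems.SAWLoopFugacityFlowAvoidanceLimitSawEndpoint
import Summits.CriticalPhenomena.SAWScalingLimit.Theorems.SAWLoopFugacityFlowAvoidanceLimitSawCriticalPoint

/-!
# Strategy census sketch for the crux `AvoidanceLimit` (stmt-CriticalPhenomena-10649)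

Planner seat `planner-cstrat-stmt-CriticalPhenomena-10649-s1-0` (crux-strategist, 2026-08-17).
This file TYPES the statements quoted in `STRATEGY-CENSUS.md` (Transfer / Strengthen /
Decomposition / Negation) over the tree's own declarations and proves the elementary glue claims
made there, so that the census carries signatures rather than prose. Nothing here is a line or a
stub; nothing is registered. `sorry`-free.

Contents
* §D1 `RestrictionForm`, `ExponentPin`, `avoidanceLimit_of_restrictionForm` — the value-free /
  value split: `(∃ α, AvoidanceLimitExp α) ∧ (T → S → pin) ∧ T ∧ S ⇒ crux` (pure logic through
  `avoidanceLimitExp_iff`). `RestrictionForm` is VERBATIM the registered stub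
  `stub_restrictionForm` of line `thin-fill-pins-exponent`; the pin architecture is the sibling
  route `SAWFrontierHomotopy` (`OneSidedPowerLaw` stmt-10702 + `OneSidedClosing` stmt-4537).
* §D2 `OneApproxLimit`, `EndpointInsensitivity`, `avoidanceLimit_of_oneApprox` — the
  geometry / universality split of the quantifier "for EVERY endpoint approximation".
* §S1 `FamilyForm`, `avoidanceLimit_of_familyForm` — the continuation lines' implicit
  strengthening (restriction covariance with the Coulomb-gas exponent for every `s ∈ [-2, 0]`),
  reduced to the crux by the LANDED stubs S1 (`Anchor.stub_sawEndpoint`) and S7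
  (`Anchor.stub_sawCriticalPoint`).
* §S2 `RateForm`, `avoidanceLimit_of_rateForm` — the quantitative strengthening.
* §S3 `ExistsExponentWindow` — the ∃-exponent WEAKENING of the live line's S4 recommended in the
  census (typed only).
* §N checks against the landed `Negative/` family.
-/

noncomputable section

open scoped Topology
open Filter Set
open Literature.Probability.RandomPlanarGeometry Literature.Probability.LatticeModels
open Summit.CriticalPhenomena.SAWScalingLimit.Theses.SAWLoopFugacityFlow
  (AvoidanceLimit EventualTight SimpleSubseqLimits)
open Summit.CriticalPhenomena.SAWScalingLimit.Theorems.AvoidanceLimit.Negative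
  (AvoidanceLimitExp avoidanceLimitExp_iff avoidanceLimit_not_exp_one avoidanceLimitExp_unique
    map_law_apply_le_one)
open Summit.CriticalPhenomena.SAWScalingLimit.Theorems.AvoidanceLimit.Anchor
  (Rδ xcDim bExp bExp_zero)

namespace Summit.CriticalPhenomena.SAWScalingLimit.Cruxes.AvoidanceLimit.StrategyCensus

/-! ### Common shape: the conclusion of the crux for ONE hull datum and ONE endpoint approximation -/

/-- The crux's conclusion for fixed `(D, D', a, b)`, exponent `p` (so that `p = 5/8` is the crux's
own tail and general `p` is the tail of `AvoidanceLimitExp p`). -/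
def HullLimit (p : ℝ) (D D' : DobrushinDomain) (a b : ℝ → Site 2) : Prop :=
  D'.carrier ⊆ D.carrier → D'.pt 0 = D.pt 0 → D'.pt 1 = D.pt 1 →
    (∃ ε : ℝ, 0 < ε ∧ D'.carrier ∩ Metric.ball (D.pt 0) ε = D.carrier ∩ Metric.ball (D.pt 0) ε ∧
      D'.carrier ∩ Metric.ball (D.pt 1) ε = D.carrier ∩ Metric.ball (D.pt 1) ε) →
    ∀ (φ : ConformalEquiv UpperHalfPlane.upperHalfPlaneSet D.carrier), D.IsChordalUniformizing φ →
    ∀ (A : Set ℂ), A = closure (UpperHalfPlane.upperHalfPlaneSet \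
      {z | z ∈ UpperHalfPlane.upperHalfPlaneSet ∧ φ z ∈ D'.carrier}) →
    ∀ (Φ : ConformalEquiv (UpperHalfPlane.upperHalfPlaneSet \ A) UpperHalfPlane.upperHalfPlaneSet)
      (d : ℝ), IsRestrictionMap A Φ → HasRestrictionDeriv A Φ d →
    Tendsto (fun δ => ((SAW.law D.carrier δ (a δ) (b δ)).map (fun γ => γ.curve))
      (CurveClass.rangeSubset (closure D'.carrier))) (𝓝[>] 0) (𝓝 (ENNReal.ofReal (d ^ p)))

/-- The crux is the `∀ (D, D', a, b)`-closure of `HullLimit (5/8)` (definitional). -/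
theorem avoidanceLimit_iff_forall_hullLimit :
    AvoidanceLimit ↔ ∀ (D D' : DobrushinDomain) (a b : ℝ → Site 2),
      SAW.IsEndpointApprox D a b → HullLimit ((5 : ℝ) / 8) D D' a b :=
  ⟨fun h D D' a b hab => h D D' a b hab, fun h D D' a b hab => h D D' a b hab⟩

/-- The exponent family is the same closure of `HullLimit p` (definitional). -/
theorem avoidanceLimitExp_iff_forall_hullLimit (p : ℝ) :
    AvoidanceLimitExp p ↔ ∀ (D D' : DobrushinDomain) (a b : ℝ → Site 2),
      SAW.IsEndpointApprox D a b → HullLimit p D D' a b :=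
  ⟨fun h D D' a b hab => h D D' a b hab, fun h D D' a b hab => h D D' a b hab⟩

/-! ### §D1 Decomposition 1 — value-free restriction form + exponent pin -/

/-- `Sub₁` — the VALUE-FREE restriction form: one exponent `α` for all hull data (verbatim the
registered stub `stub_restrictionForm` of line `thin-fill-pins-exponent`; strictly weaker than
the crux, which is the member `α = 5/8`, `avoidanceLimitExp_iff`). -/
def RestrictionForm : Prop := ∃ α : ℝ, AvoidanceLimitExp α

/-- `Sub₂` — the EXPONENT PIN, conditional on the route's own items `(T) EventualTight` and
`(S) SimpleSubseqLimits`: a subsequential curve limit exists (T, Prokhorov), is carried by simple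
chords (S), inherits `P(avoid) = Φ'_A(0)^α` (portmanteau sandwich, cf. `AvoidancePassage`), hence
its pull-back to `ℍ` is a two-sided restriction measure on simple curves, so `α = 5/8` by the
DISCHARGED [LSW03] facts `IsRestrictionMeasure.eq_five_eighths_of_outer_simple_holds`,
`exists_isRestrictionMeasure_iff_holds`. Provable now (L: packaging); it is item
`SAWFrontierHomotopy.OneSidedClosing` (stmt-4537) in one-sided dress. -/
def ExponentPin : Prop :=
  EventualTight → SimpleSubseqLimits → ∀ α : ℝ, AvoidanceLimitExp α → α = (5 : ℝ) / 8

/-- The split's glue: `Sub₁ → Sub₂ → T → S → crux` (pure logic + `avoidanceLimitExp_iff`). The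
route's deciding theorem `closes` already takes `T` and `S` as hypotheses, so at ROUTE level the
crux could be re-based on `RestrictionForm`; inside the crux the split needs `T`, `S` as children. -/
theorem avoidanceLimit_of_restrictionForm (h₁ : RestrictionForm) (h₂ : ExponentPin)
    (hT : EventualTight) (hS : SimpleSubseqLimits) : AvoidanceLimit := by
  obtain ⟨α, hα⟩ := h₁
  have h58 : α = (5 : ℝ) / 8 := h₂ hT hS α hα
  subst h58
  exact avoidanceLimitExp_iff.mp hα

/-- Conversely the crux gives both pieces (so the split is into CONSEQUENCES of the crux, each
strictly weaker: `RestrictionForm` is consistent with `α = 1/2`, which the crux refutes). -/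
theorem restrictionForm_and_pin_of_avoidanceLimit (h : AvoidanceLimit) :
    RestrictionForm ∧ ExponentPin :=
  ⟨⟨(5 : ℝ) / 8, avoidanceLimitExp_iff.mpr h⟩,
    fun _ _ _ hα => avoidanceLimitExp_unique hα (avoidanceLimitExp_iff.mpr h)⟩

/-! ### §D2 Decomposition 2 — one approximation per geometry + endpoint insensitivity -/

/-- `Sub₁'` — the crux for SOME endpoint approximation of each Dobrushin domain (the conformal
content: existence and value of the limit in one discretisation per geometry). -/
def OneApproxLimit : Prop :=
  ∀ (D D' : DobrushinDomain), ∃ a b : ℝ → Site 2,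
    SAW.IsEndpointApprox D a b ∧ HullLimit ((5 : ℝ) / 8) D D' a b

/-- `Sub₂'` — ENDPOINT INSENSITIVITY (a value-free, conformal-free lattice statement: the avoidance
probability forgets the microscopic position of the endpoints inside their prime ends — the SAW
analogue of a ratio boundary Harnack principle; Disproof.lean point 10). -/
def EndpointInsensitivity : Prop :=
  ∀ (D D' : DobrushinDomain) (a b a' b' : ℝ → Site 2), SAW.IsEndpointApprox D a b →
    SAW.IsEndpointApprox D a' b' → ∀ L : ENNReal,
    Tendsto (fun δ => ((SAW.law D.carrier δ (a δ) (b δ)).map (fun γ => γ.curve))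
      (CurveClass.rangeSubset (closure D'.carrier))) (𝓝[>] 0) (𝓝 L) →
    Tendsto (fun δ => ((SAW.law D.carrier δ (a' δ) (b' δ)).map (fun γ => γ.curve))
      (CurveClass.rangeSubset (closure D'.carrier))) (𝓝[>] 0) (𝓝 L)

/-- The split's glue: `Sub₁' → Sub₂' → crux`. -/
theorem avoidanceLimit_of_oneApprox (h₁ : OneApproxLimit) (h₂ : EndpointInsensitivity) :
    AvoidanceLimit := by
  intro D D' a b hab hsub hp0 hp1 hball φ hφ A hA Φ d hΦ hd
  obtain ⟨a₀, b₀, hab₀, hlim⟩ := h₁ D D'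
  exact h₂ D D' a₀ b₀ a b hab₀ hab _ (hlim hsub hp0 hp1 hball φ hφ A hA Φ d hΦ hd)

/-! ### §S1 Strengthening 1 — the continuation family (what every `n`-continuation line proves) -/

/-- Along an endpoint approximation, eventually `δ > 0` and `a_δ ≠ b_δ` (reachability-free part of
the live skeleton's `eventually_good`). -/
theorem eventually_pos_ne {D : DobrushinDomain} {a b : ℝ → Site 2}
    (hab : SAW.IsEndpointApprox D a b) : ∀ᶠ δ in 𝓝[>] (0 : ℝ), 0 < δ ∧ a δ ≠ b δ := by
  have h0 : ∀ᶠ δ in 𝓝[>] (0 : ℝ), 0 < δ := eventually_mem_nhdsWithin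
  have hpq : D.pt 0 ≠ D.pt 1 := fun h => absurd (D.pt_injective h) (by decide)
  have hr : 0 < dist (D.pt 0) (D.pt 1) / 2 := by
    have := dist_pos.2 hpq
    positivity
  have ha := (Metric.tendsto_nhds.1 hab.tendsto_fst) _ hr
  have hb := (Metric.tendsto_nhds.1 hab.tendsto_snd) _ hr
  filter_upwards [h0, ha, hb] with δ hδ hδa hδb
  refine ⟨hδ, fun heq => ?_⟩
  rw [heq] at hδa
  have h3 := dist_triangle (D.pt 0) (meshPoint δ (b δ)) (D.pt 1)
  rw [dist_comm] at hδa
  linarith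

/-- `S⁺₁` — restriction covariance WITH the Coulomb-gas exponent `bExp s` for EVERY loop fugacity
`s ∈ [-2, 0]` of the loop+dimer dressed walk along `(s, s/2, x_c(s, s/2))` (the symplectic line's
window + continuation, globalised): strictly stronger than the crux, which is its `s = 0` member. -/
def FamilyForm : Prop :=
  ∀ s ∈ Set.Icc (-2 : ℝ) 0, ∀ (D D' : DobrushinDomain) (a b : ℝ → Site 2),
    SAW.IsEndpointApprox D a b →
    D'.carrier ⊆ D.carrier → D'.pt 0 = D.pt 0 → D'.pt 1 = D.pt 1 →
    (∃ ε : ℝ, 0 < ε ∧ D'.carrier ∩ Metric.ball (D.pt 0) ε = D.carrier ∩ Metric.ball (D.pt 0) ε ∧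
      D'.carrier ∩ Metric.ball (D.pt 1) ε = D.carrier ∩ Metric.ball (D.pt 1) ε) →
    ∀ (φ : ConformalEquiv UpperHalfPlane.upperHalfPlaneSet D.carrier), D.IsChordalUniformizing φ →
    ∀ (A : Set ℂ), A = closure (UpperHalfPlane.upperHalfPlaneSet \
      {z | z ∈ UpperHalfPlane.upperHalfPlaneSet ∧ φ z ∈ D'.carrier}) →
    ∀ (Φ : ConformalEquiv (UpperHalfPlane.upperHalfPlaneSet \ A) UpperHalfPlane.upperHalfPlaneSet)
      (d : ℝ), IsRestrictionMap A Φ → HasRestrictionDeriv A Φ d →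
    Tendsto (fun δ => Rδ s (s / 2) (xcDim s (s / 2)) D.carrier D'.carrier δ (a δ) (b δ))
      (𝓝[>] 0) (𝓝 (d ^ bExp s))

/-- `S⁺₁ ⇒ crux`, through the LANDED stubs S7 (`x_c(0,0) = 1/μ`) and S1 (the ratio at `(0,0,x_c)` IS
the avoidance probability) and `bExp 0 = 5/8`. -/
theorem avoidanceLimit_of_familyForm (h : FamilyForm) : AvoidanceLimit := by
  intro D D' a b hab hsub hp0 hp1 hball φ hφ A hA Φ d hΦ hd
  have h0 := h 0 ⟨by norm_num, le_rfl⟩ D D' a b hab hsub hp0 hp1 hball φ hφ A hA Φ d hΦ hd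
  rw [bExp_zero] at h0
  have h7 : xcDim 0 0 = SAW.criticalFugacity :=
    Theorems.AvoidanceLimit.Anchor.stub_sawCriticalPoint
  simp only [zero_div] at h0
  rw [h7] at h0
  refine (ENNReal.tendsto_ofReal h0).congr' ?_
  filter_upwards [eventually_pos_ne hab] with δ hδ
  exact (Theorems.AvoidanceLimit.Anchor.stub_sawEndpoint D.carrier D'.carrier δ (a δ) (b δ)
    D.isBounded hδ.1 hδ.2).symm

/-! ### §S2 Strengthening 2 — a rate -/

/-- `S⁺₂` — the crux with a power-law RATE in the mesh. -/
def RateForm : Prop :=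
  ∃ θ : ℝ, 0 < θ ∧ ∀ (D D' : DobrushinDomain) (a b : ℝ → Site 2), SAW.IsEndpointApprox D a b →
    D'.carrier ⊆ D.carrier → D'.pt 0 = D.pt 0 → D'.pt 1 = D.pt 1 →
    (∃ ε : ℝ, 0 < ε ∧ D'.carrier ∩ Metric.ball (D.pt 0) ε = D.carrier ∩ Metric.ball (D.pt 0) ε ∧
      D'.carrier ∩ Metric.ball (D.pt 1) ε = D.carrier ∩ Metric.ball (D.pt 1) ε) →
    ∀ (φ : ConformalEquiv UpperHalfPlane.upperHalfPlaneSet D.carrier), D.IsChordalUniformizing φ →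
    ∀ (A : Set ℂ), A = closure (UpperHalfPlane.upperHalfPlaneSet \
      {z | z ∈ UpperHalfPlane.upperHalfPlaneSet ∧ φ z ∈ D'.carrier}) →
    ∀ (Φ : ConformalEquiv (UpperHalfPlane.upperHalfPlaneSet \ A) UpperHalfPlane.upperHalfPlaneSet)
      (d : ℝ), IsRestrictionMap A Φ → HasRestrictionDeriv A Φ d →
    ∃ C : ℝ, ∀ᶠ δ in 𝓝[>] (0 : ℝ),
      |(((SAW.law D.carrier δ (a δ) (b δ)).map (fun γ => γ.curve))
          (CurveClass.rangeSubset (closure D'.carrier))).toReal - d ^ ((5 : ℝ) / 8)| ≤ C * δ ^ θ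

/-- `S⁺₂ ⇒ crux` (squeeze; the pushed-forward law has total mass `≤ 1`, so no `⊤` junk). -/
theorem avoidanceLimit_of_rateForm (h : RateForm) : AvoidanceLimit := by
  obtain ⟨θ, hθ, h⟩ := h
  intro D D' a b hab hsub hp0 hp1 hball φ hφ A hA Φ d hΦ hd
  obtain ⟨C, hC⟩ := h D D' a b hab hsub hp0 hp1 hball φ hφ A hA Φ d hΦ hd
  set P : ℝ → ENNReal := fun δ => ((SAW.law D.carrier δ (a δ) (b δ)).map (fun γ => γ.curve))
    (CurveClass.rangeSubset (closure D'.carrier)) with hP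
  have hne : ∀ δ, P δ ≠ ⊤ := fun δ =>
    ne_top_of_le_ne_top ENNReal.one_ne_top (map_law_apply_le_one _ _ _ _ _)
  -- the real-valued version converges
  have hpow : Tendsto (fun δ : ℝ => C * δ ^ θ) (𝓝[>] (0 : ℝ)) (𝓝 0) := by
    have hc : ContinuousAt (fun δ : ℝ => δ ^ θ) 0 := Real.continuousAt_rpow_const 0 θ (Or.inr hθ.le)
    have h1 : Tendsto (fun δ : ℝ => δ ^ θ) (𝓝[>] (0 : ℝ)) (𝓝 0) := by
      have := hc.tendsto
      rw [Real.zero_rpow hθ.ne'] at this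
      exact tendsto_nhdsWithin_of_tendsto_nhds this
    simpa using h1.const_mul C
  have hreal : Tendsto (fun δ => (P δ).toReal) (𝓝[>] (0 : ℝ)) (𝓝 (d ^ ((5 : ℝ) / 8))) := by
    rw [tendsto_iff_norm_sub_tendsto_zero]
    refine squeeze_zero' (Eventually.of_forall fun δ => norm_nonneg _) ?_ hpow
    filter_upwards [hC] with δ hδ
    simpa [Real.norm_eq_abs, hP] using hδ
  have key : Tendsto (fun δ => ENNReal.ofReal ((P δ).toReal)) (𝓝[>] (0 : ℝ))
      (𝓝 (ENNReal.ofReal (d ^ ((5 : ℝ) / 8)))) := ENNReal.tendsto_ofReal hreal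
  refine key.congr' (Eventually.of_forall fun δ => ?_)
  simp only [hP]
  exact ENNReal.ofReal_toReal (hne δ)

/-! ### §S3 The ∃-exponent weakening of the live line's window (census advice; typed only) -/

/-- `S4∃` — the symplectic window WITHOUT the closed-form exponent: some function `β` on the window
such that the ratio converges to `d^(β s)`. With S5 (normal family on `U ∋ 0`), Vitali and ONE
positivity input at `s = 0` (`liminf_δ P_δ(avoid) > 0`, the strip-window shadow of the crux — or an
analytic-extension clause on `β`; Hurwitz then makes the limit zero-free) this yields
`RestrictionForm` (`α :=` the continuation of `β` at `0`, datum-independent by the identity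
theorem), NOT the valued crux — which is exactly what `ExponentPin` /
`SAWFrontierHomotopy.OneSidedClosing` then complete inside this route's `closes` (it already
carries `T` and `S`). In the valued line the explicit continuation `d^(bExp z) ≠ 0` supplies the
positivity at `0` for free; that is the only work the closed form does. -/
def ExistsExponentWindow : Prop :=
  ∃ ε₀ : ℝ, 0 < ε₀ ∧ ∃ β : ℝ → ℝ, ∀ s ∈ Set.Ioc (-2 : ℝ) (-2 + ε₀),
    ∀ (D D' : DobrushinDomain) (a b : ℝ → Site 2), SAW.IsEndpointApprox D a b →
    D'.carrier ⊆ D.carrier → D'.pt 0 = D.pt 0 → D'.pt 1 = D.pt 1 →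
    (∃ ε : ℝ, 0 < ε ∧ D'.carrier ∩ Metric.ball (D.pt 0) ε = D.carrier ∩ Metric.ball (D.pt 0) ε ∧
      D'.carrier ∩ Metric.ball (D.pt 1) ε = D.carrier ∩ Metric.ball (D.pt 1) ε) →
    ∀ (φ : ConformalEquiv UpperHalfPlane.upperHalfPlaneSet D.carrier), D.IsChordalUniformizing φ →
    ∀ (A : Set ℂ), A = closure (UpperHalfPlane.upperHalfPlaneSet \
      {z | z ∈ UpperHalfPlane.upperHalfPlaneSet ∧ φ z ∈ D'.carrier}) →
    ∀ (Φ : ConformalEquiv (UpperHalfPlane.upperHalfPlaneSet \ A) UpperHalfPlane.upperHalfPlaneSet)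
      (d : ℝ), IsRestrictionMap A Φ → HasRestrictionDeriv A Φ d →
    Tendsto (fun δ => Rδ s (s / 2) (xcDim s (s / 2)) D.carrier D'.carrier δ (a δ) (b δ))
      (𝓝[>] 0) (𝓝 (d ^ β s))

/-! ### §N Negation — checks against the landed `Negative/` family -/

/-- The crux pins the exponent: it refutes the excursion value `1` (so no exponent-blind argument,
and no transfer of the `b = 1` anchor WITHOUT a window, can close it). -/
example (h : AvoidanceLimit) : ¬ AvoidanceLimitExp 1 := avoidanceLimit_not_exp_one h

/-- `RestrictionForm` is a CONSEQUENCE of the crux (so `Sub₁` of §D1 is weaker, not a costume). -/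
example (h : AvoidanceLimit) : RestrictionForm := (restrictionForm_and_pin_of_avoidanceLimit h).1

end Summit.CriticalPhenomena.SAWScalingLimit.Cruxes.AvoidanceLimit.StrategyCensus

end
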